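import Summits.SmoothPoincare4.SmoothPoincare4.Theorems.SullivanDualTargetStubCollar
import Literature.Geometry.Symplectic.SphereOpenBookForm
import Literature.Geometry.Kaehler.ManifoldFormsFunSmulProofs

/-!
# SmoothPoincare4 / SullivanDual — crux `Target` (stmt-SmoothPoincare4-7823), line `Sketch`:
# closed-exact taming kills witnesses (registered stub `stub_ctkwOfInputs`)

The reduction of route SullivanDual's target to `WeakTameExact` ("every punctured homotopy
4-sphere carries a `J` standard near the puncture and a smooth `1`-form `γ` with `dγ` taming
`J`"): **if `J` on `M ∖ p` is standard on the punctured `ε'`-chart-ball and `dγ` tames `J`,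
then `J` has no taming witness at any radius `ε < ε'`** — here with the four analytic inputs
of the line's skeleton as explicit hypotheses (`stub_ctkwOfInputs`): (A) a flat cut-off form
`Ω` on `ℝ⁴` (closed, `0` near the origin, `ω₀` far out, `J₀`-non-negative, uniformly
`J₀`-positive on an outer shell), (B) a smooth cut-off `Φ` of the inverted recentred chart with
prescribed radius, (C) chart-norm bounds of smooth `2`-forms on a compact chart collar, (D) a
smooth cut-off function adapted to two punctured chart-balls.  They are discharged in the
sibling files `SullivanDualTargetStub{OmegaFlat,InvChartMap,FormBound,Cutoff}`.

§1 builds the **collar form** `ω̃ = Φ^*Ω` and reads off its properties through the chain rule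
`dΦ = Dι(e x − e p) ∘ De` on the standard ball (`exists_collarForm`); §2 runs the argument:
`dγ = d(φγ) + d((1−φ)γ)`, (W2) kills the first summand (closed, vanishing on `B_ε`), the
collar lemma `stub_collar` the second (supported in `B_{ε₃}`), contradicting (W1) for `dγ`.

References: D. Sullivan, Invent. Math. 36 (1976), Thm. I.7 [Sullivan1976]; M. Gromov, Invent.
Math. 82 (1985), §0.3.C [Gromov1985]; F. W. Warner, GTM 94 (1983), 2.22–2.23 [WarnerGTM94].
-/

noncomputable section

-- the registered namespace `Summit.SmoothPoincare4.SmoothPoincare4.Theorems` repeats a component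
set_option linter.dupNamespace false

open scoped Manifold ContDiff Topology InnerProductSpace
open Set Filter Metric
open Literature.Geometry.Kaehler Literature.Geometry.Symplectic

namespace Summit.SmoothPoincare4.SmoothPoincare4.Theorems

namespace SullivanDual

/-! ### §1 The collar form on the punctured manifold -/

section CollarForm

variable {M : Type*} [TopologicalSpace M] [T2Space M] [ChartedSpace (EuclideanSpace ℝ (Fin 4)) M]
  [IsManifold (𝓡 4) ∞ M]

/-- A `C^∞` form on flat `ℝ⁴` (as a map `ℝ⁴ → ℝ⁴ [⋀^Fin k]→L[ℝ] ℝ`) is a smooth `MForm` on the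
manifold `ℝ⁴`. [folklore] -/
theorem isSmoothForm_flat_of_contDiff {k : ℕ}
    {Ω : EuclideanSpace ℝ (Fin 4) → (EuclideanSpace ℝ (Fin 4)) [⋀^Fin k]→L[ℝ] ℝ}
    (hΩ : ContDiff ℝ ∞ Ω) : IsSmoothForm (I := 𝓡 4) (M := EuclideanSpace ℝ (Fin 4)) Ω :=
  (isSmoothForm_iff_smoothAt _).2 fun z => SphereOpenBook.smoothAt_flat_of_contDiff hΩ z

/-- A `C^∞` form on flat `ℝ⁴` which is closed for Mathlib's `extDeriv` is a closed `MForm`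
(`mextDeriv = extDeriv` on the model space). [folklore] -/
theorem isClosedForm_flat_of_extDeriv_eq_zero {k : ℕ}
    {Ω : EuclideanSpace ℝ (Fin 4) → (EuclideanSpace ℝ (Fin 4)) [⋀^Fin k]→L[ℝ] ℝ}
    (hΩc : ∀ w, extDeriv Ω w = 0) :
    mextDeriv (I := 𝓡 4) (M := EuclideanSpace ℝ (Fin 4)) Ω = 0 := by
  funext w
  rw [mextDeriv_eq_extDeriv]
  exact hΩc w

/-- **The collar form.** Transport of a flat cut-off form `Ω` (vanishing on the closed
`ε₄⁻¹`-ball, equal to `ω₀` outside the `ε⁻¹`-ball, `J₀`-non-negative, uniformly `J₀`-positive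
outside the `ε₃⁻¹`-ball) along a smooth map `Φ : M ∖ p → ℝ⁴` that is the inverted recentred
chart on the punctured `ε'`-ball and has norm `≤ ε'⁻¹` off it, for `J` standard on the
punctured `ε'`-ball, `ε < ε₃ < ε₄ < ε'`: the pull-back `ω̃ = Φ^*Ω` is smooth, closed, standard
on the `ε`-ball, `J`-non-negative everywhere, and `ω̃(v, Jv) ≥ c ‖A v‖²` on the punctured
`ε₃`-ball (`A = Dι(e x − e p) ∘ De_x`). [folklore] -/
theorem exists_collarForm (p : M)
    (J : ∀ x : punctured p, TangentSpace (𝓡 4) x →L[ℝ] TangentSpace (𝓡 4) x)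
    {ε ε₃ ε₄ ε' : ℝ} (hε : 0 < ε) (hε₃ : ε < ε₃) (hε₄ : ε₃ < ε₄) (hε' : ε₄ < ε')
    (hstd : ∀ x : punctured p, InPuncturedChartBall p ε' x →
        ∀ (v : TangentSpace (𝓡 4) x) (b : EuclideanSpace ℝ (Fin 4)),
        inner ℝ (fderiv ℝ inversion (extChartAt (𝓡 4) p x.1 - extChartAt (𝓡 4) p p)
          (mfderiv (𝓡 4) 𝓘(ℝ, EuclideanSpace ℝ (Fin 4))
            (fun z : punctured p => extChartAt (𝓡 4) p z.1) x (J x v))) b =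
        stdSymplecticForm (fderiv ℝ inversion (extChartAt (𝓡 4) p x.1 - extChartAt (𝓡 4) p p)
          (mfderiv (𝓡 4) 𝓘(ℝ, EuclideanSpace ℝ (Fin 4))
            (fun z : punctured p => extChartAt (𝓡 4) p z.1) x v)) b)
    {Ω : EuclideanSpace ℝ (Fin 4) → (EuclideanSpace ℝ (Fin 4)) [⋀^Fin 2]→L[ℝ] ℝ}
    (hΩs : ContDiff ℝ ∞ Ω) (hΩc : ∀ w, extDeriv Ω w = 0)
    (hΩ0 : ∀ w, ‖w‖ ≤ ε₄⁻¹ → Ω w = 0)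
    (hΩstd : ∀ w, ε⁻¹ ≤ ‖w‖ → ∀ a b, Ω w ![a, b] = stdSymplecticForm a b)
    (hΩnn : ∀ w a, 0 ≤ Ω w ![a, stdComplexStructure a])
    {c : ℝ} (hΩpos : ∀ w, ε₃⁻¹ ≤ ‖w‖ → ∀ a, c * ‖a‖ ^ 2 ≤ Ω w ![a, stdComplexStructure a])
    {Φ : punctured p → EuclideanSpace ℝ (Fin 4)} (hΦs : ContMDiff (𝓡 4) (𝓡 4) ∞ Φ)
    (hΦeq : ∀ x : punctured p, InPuncturedChartBall p ε' x →
        Φ x = inversion (extChartAt (𝓡 4) p x.1 - extChartAt (𝓡 4) p p))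
    (hΦle : ∀ x : punctured p, ¬ InPuncturedChartBall p ε' x → ‖Φ x‖ ≤ ε'⁻¹) :
    ∃ ω' : MForm (𝓡 4) (punctured p) ℝ 2, IsSmoothForm ω' ∧ IsClosedForm ω' ∧
      IsStandardOnBall p ε ω' ∧
      (∀ (x : punctured p) (v : TangentSpace (𝓡 4) x), 0 ≤ ω' x ![v, J x v]) ∧
      (∀ x : punctured p, InPuncturedChartBall p ε₃ x → ∀ v : TangentSpace (𝓡 4) x,
        c * ‖fderiv ℝ inversion (extChartAt (𝓡 4) p x.1 - extChartAt (𝓡 4) p p)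
          (mfderiv (𝓡 4) 𝓘(ℝ, EuclideanSpace ℝ (Fin 4))
            (fun z : punctured p => extChartAt (𝓡 4) p z.1) x v)‖ ^ 2 ≤ ω' x ![v, J x v]) := by
  have hε₃pos : 0 < ε₃ := hε.trans hε₃
  have hε₄pos : 0 < ε₄ := hε₃pos.trans hε₄
  have hε'pos : 0 < ε' := hε₄pos.trans hε'
  set e := extChartAt (𝓡 4) p with he
  -- the flat form as a form on the manifold `ℝ⁴`, and its pull-back
  set Ωm : MForm (𝓡 4) (EuclideanSpace ℝ (Fin 4)) ℝ 2 := fun w => Ω w with hΩm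
  have hΩm_s : IsSmoothForm Ωm := isSmoothForm_flat_of_contDiff hΩs
  set ω' : MForm (𝓡 4) (punctured p) ℝ 2 := Ωm.pullback (𝓡 4) Φ with hω'
  -- evaluation of the pull-back
  have heval : ∀ (x : punctured p) (v w : TangentSpace (𝓡 4) x),
      ω' x ![v, w] = Ω (Φ x) ![mfderiv (𝓡 4) (𝓡 4) Φ x v, mfderiv (𝓡 4) (𝓡 4) Φ x w] := by
    intro x v w
    rw [hω', MForm.pullback_apply]
    have h : (fun i => mfderiv (𝓡 4) (𝓡 4) Φ x (![v, w] i)) =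
        ![mfderiv (𝓡 4) (𝓡 4) Φ x v, mfderiv (𝓡 4) (𝓡 4) Φ x w] := by
      funext i; fin_cases i <;> rfl
    rw [h]
    rfl
  -- on the punctured `ε'`-ball `dΦ = Dι(e x − e p) ∘ De`
  have hdΦ : ∀ x : punctured p, InPuncturedChartBall p ε' x → ∀ v : TangentSpace (𝓡 4) x,
      mfderiv (𝓡 4) (𝓡 4) Φ x v = fderiv ℝ inversion (e x.1 - e p)
        (mfderiv (𝓡 4) 𝓘(ℝ, EuclideanSpace ℝ (Fin 4)) (fun z : punctured p => e z.1) x v) := by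
    intro x hx v
    have hev : Φ =ᶠ[𝓝 x] fun z : punctured p => inversion (e z.1 - e p) :=
      Filter.eventuallyEq_of_mem ((isOpen_setOf_inPuncturedChartBall p ε').mem_nhds hx)
        fun z hz => hΦeq z hz
    have hΦ' := (hasMFDerivAt_inversion_extChartAt_sub p x hx.1).congr_of_eventuallyEq hev
    rw [hΦ'.mfderiv]
    rfl
  -- off the punctured `ε'`-ball the form vanishes
  have hzero : ∀ x : punctured p, ¬ InPuncturedChartBall p ε' x → ω' x = 0 := by
    intro x hx
    have hn : ‖Φ x‖ ≤ ε₄⁻¹ :=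
      (hΦle x hx).trans ((inv_le_inv₀ hε'pos hε₄pos).2 hε'.le)
    have h0 : Ω (Φ x) = 0 := hΩ0 _ hn
    show (Ωm (Φ x)).compContinuousLinearMap (mfderiv (𝓡 4) (𝓡 4) Φ x) = 0
    rw [show Ωm (Φ x) = Ω (Φ x) from rfl, h0]
    rfl
  -- norms in the punctured `ε'`-ball: `‖ι(e x − e p)‖ = ‖e x − e p‖⁻¹ > ρ⁻¹` for `x ∈ B_ρ`
  have hnorm : ∀ {ρ : ℝ} (x : punctured p), 0 < ρ → InPuncturedChartBall p ρ x →
      ρ⁻¹ ≤ ‖inversion (e x.1 - e p)‖ := by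
    intro ρ x hρ hx
    rw [norm_inversion]
    have hlt := norm_extChartAt_sub_lt p hx
    have hpos : 0 < ‖e x.1 - e p‖ := norm_pos_iff.2 (extChartAt_sub_ne_zero p hx)
    exact (inv_le_inv₀ hρ hpos).2 hlt.le
  -- `J` is standard: `A (J v) = J₀ (A v)` on the punctured `ε'`-ball
  have hJstd : ∀ x : punctured p, InPuncturedChartBall p ε' x → ∀ v : TangentSpace (𝓡 4) x,
      fderiv ℝ inversion (e x.1 - e p)
        (mfderiv (𝓡 4) 𝓘(ℝ, EuclideanSpace ℝ (Fin 4)) (fun z : punctured p => e z.1) x (J x v)) =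
      stdComplexStructure (fderiv ℝ inversion (e x.1 - e p)
        (mfderiv (𝓡 4) 𝓘(ℝ, EuclideanSpace ℝ (Fin 4)) (fun z : punctured p => e z.1) x v)) :=
    fun x hx v => eq_stdComplexStructure_of_inner_eq (hstd x hx v)
  refine ⟨ω', Literature.NumberTheory.Transcendental.isSmoothForm_pullback hΦs hΩm_s, ?_, ?_, ?_, ?_⟩
  · -- closed: `d(Φ^*Ω) = Φ^*(dΩ) = 0`
    show mextDeriv ω' = 0
    rw [hω', Literature.NumberTheory.Transcendental.mextDeriv_pullback hΦs hΩm_s,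
      show mextDeriv Ωm = 0 from isClosedForm_flat_of_extDeriv_eq_zero hΩc, MForm.pullback_zero]
  · -- standard on the punctured `ε`-ball
    intro x hx v w
    have hx' : InPuncturedChartBall p ε' x := hx.mono (hε₃.le.trans (hε₄.le.trans hε'.le))
    rw [heval, hdΦ x hx' v, hdΦ x hx' w, hΦeq x hx',
      hΩstd _ (hnorm x hε hx)]
    rfl
  · -- `J`-non-negative everywhere
    intro x v
    by_cases hx : InPuncturedChartBall p ε' x
    · rw [heval, hdΦ x hx v, hdΦ x hx (J x v), hJstd x hx v]
      exact hΩnn _ _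
    · rw [hzero x hx]
      simp
  · -- uniformly `J`-positive on the punctured `ε₃`-ball
    intro x hx v
    have hx' : InPuncturedChartBall p ε' x := hx.mono (hε₄.le.trans hε'.le)
    rw [heval, hdΦ x hx' v, hdΦ x hx' (J x v), hJstd x hx' v, hΦeq x hx']
    exact hΩpos _ (hnorm x hε₃pos hx) _

end CollarForm

/-! ### §2 Closed-exact taming kills witnesses, from the four analytic inputs (stub `stub_ctkwOfInputs`) -/

section Ctkw

variable {M : Type*} [TopologicalSpace M] [T2Space M] [ChartedSpace (EuclideanSpace ℝ (Fin 4)) M]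
  [IsManifold (𝓡 4) ∞ M]

/-- **Closed-exact taming kills witnesses (all analytic inputs explicit).** Let `J` on `M ∖ p`
be standard on the punctured `ε'`-chart-ball, `0 < ε < ε₃ < ε₄ < ε'`, and let `γ` be a smooth
`1`-form with `dγ(v, Jv) > 0` for `v ≠ 0` everywhere. Given (A) a flat cut-off form `Ω` on
`ℝ⁴` (closed, `0` on the closed `ε₄⁻¹`-ball, `ω₀` outside the `ε⁻¹`-ball, `J₀`-non-negative,
uniformly `J₀`-positive outside the `ε₃⁻¹`-ball), (B) a smooth `Φ : M ∖ p → ℝ⁴` equal to the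
inverted recentred chart on the punctured `ε'`-ball with norm `≤ ε'⁻¹` off it, (C) chart-norm
bounds for smooth `2`-forms on the collar `ε ≤ ‖e x − e p‖ ≤ ε₃`, and (D) a smooth cut-off
`φ`, `= 0` on `B_ε`, `= 1` near every point off `B_{ε₃}`: then `J` has no taming witness at
radius `ε`. Proof: `dγ = d(φγ) + d((1-φ)γ)`; (W2) kills the first (closed, vanishing on
`B_ε`), the collar lemma the second (supported in `B_{ε₃}`), contradicting (W1) for `dγ`.
[folklore] -/
theorem stub_ctkwOfInputs (p : M)
    (J : ∀ x : punctured p, TangentSpace (𝓡 4) x →L[ℝ] TangentSpace (𝓡 4) x)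
    {ε ε₃ ε₄ ε' : ℝ} (hε : 0 < ε) (hε₃ : ε < ε₃) (hε₄ : ε₃ < ε₄) (hε' : ε₄ < ε')
    (hstd : ∀ x : punctured p, InPuncturedChartBall p ε' x →
        ∀ (v : TangentSpace (𝓡 4) x) (b : EuclideanSpace ℝ (Fin 4)),
        inner ℝ (fderiv ℝ inversion (extChartAt (𝓡 4) p x.1 - extChartAt (𝓡 4) p p)
          (mfderiv (𝓡 4) 𝓘(ℝ, EuclideanSpace ℝ (Fin 4))
            (fun z : punctured p => extChartAt (𝓡 4) p z.1) x (J x v))) b =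
        stdSymplecticForm (fderiv ℝ inversion (extChartAt (𝓡 4) p x.1 - extChartAt (𝓡 4) p p)
          (mfderiv (𝓡 4) 𝓘(ℝ, EuclideanSpace ℝ (Fin 4))
            (fun z : punctured p => extChartAt (𝓡 4) p z.1) x v)) b)
    {γ : MForm (𝓡 4) (punctured p) ℝ 1} (hγ : IsSmoothForm γ)
    (htame : ∀ (x : punctured p) (v : TangentSpace (𝓡 4) x), v ≠ 0 →
        0 < mextDeriv γ x ![v, J x v])
    {Ω : EuclideanSpace ℝ (Fin 4) → (EuclideanSpace ℝ (Fin 4)) [⋀^Fin 2]→L[ℝ] ℝ}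
    (hΩs : ContDiff ℝ ∞ Ω) (hΩc : ∀ w, extDeriv Ω w = 0)
    (hΩ0 : ∀ w, ‖w‖ ≤ ε₄⁻¹ → Ω w = 0)
    (hΩstd : ∀ w, ε⁻¹ ≤ ‖w‖ → ∀ a b, Ω w ![a, b] = stdSymplecticForm a b)
    (hΩnn : ∀ w a, 0 ≤ Ω w ![a, stdComplexStructure a])
    {c : ℝ} (hc : 0 < c)
    (hΩpos : ∀ w, ε₃⁻¹ ≤ ‖w‖ → ∀ a, c * ‖a‖ ^ 2 ≤ Ω w ![a, stdComplexStructure a])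
    {Φ : punctured p → EuclideanSpace ℝ (Fin 4)} (hΦs : ContMDiff (𝓡 4) (𝓡 4) ∞ Φ)
    (hΦeq : ∀ x : punctured p, InPuncturedChartBall p ε' x →
        Φ x = inversion (extChartAt (𝓡 4) p x.1 - extChartAt (𝓡 4) p p))
    (hΦle : ∀ x : punctured p, ¬ InPuncturedChartBall p ε' x → ‖Φ x‖ ≤ ε'⁻¹)
    (hbound : ∀ α' : MForm (𝓡 4) (punctured p) ℝ 2, IsSmoothForm α' →
      ∃ C : ℝ, ∀ x : punctured p, x.1 ∈ (chartAt (EuclideanSpace ℝ (Fin 4)) p).source →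
        ε ≤ dist (extChartAt (𝓡 4) p x.1) (extChartAt (𝓡 4) p p) →
        dist (extChartAt (𝓡 4) p x.1) (extChartAt (𝓡 4) p p) ≤ ε₃ →
        ∀ v w : TangentSpace (𝓡 4) x,
          |α' x ![v, w]| ≤ C *
            ‖(show EuclideanSpace ℝ (Fin 4) from mfderiv (𝓡 4) 𝓘(ℝ, EuclideanSpace ℝ (Fin 4))
                (fun z : punctured p => extChartAt (𝓡 4) p z.1) x v)‖ *
            ‖(show EuclideanSpace ℝ (Fin 4) from mfderiv (𝓡 4) 𝓘(ℝ, EuclideanSpace ℝ (Fin 4))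
                (fun z : punctured p => extChartAt (𝓡 4) p z.1) x w)‖)
    {φ : punctured p → ℝ} (hφs : ContMDiff (𝓡 4) 𝓘(ℝ, ℝ) ∞ φ)
    (hφ0 : ∀ x : punctured p, InPuncturedChartBall p ε x → φ x = 0)
    (hφ1 : ∀ x : punctured p, ¬ InPuncturedChartBall p ε₃ x → ∀ᶠ z in 𝓝 x, φ z = 1) :
    NoWitness p ε J := by
  intro T hT
  have hε₃' : ε₃ < ε' := hε₄.trans hε'
  have hd : inChart_mextDeriv (𝓡 4) (punctured p) ℝ := inChart_mextDeriv_holds _ _ _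
  -- the exact taming form and (W1)
  have hsf_s : IsSmoothForm (mextDeriv γ) := isSmoothForm_mextDeriv hd hγ
  have hsft : TamesOffBall p ε J (mextDeriv γ) := fun x _ v hv => htame x v hv
  have hpos : 0 < T (mextDeriv γ) := hT.pos_of_tames hsf_s hsft
  -- the collar form and the collar lemma
  obtain ⟨ω', hω's, hω'c, hω'std, hω'nn, hω'pos⟩ :=
    exists_collarForm p J hε hε₃ hε₄ hε' hstd hΩs hΩc hΩ0 hΩstd hΩnn hΩpos hΦs hΦeq hΦle
  have hcollar : ∀ α : MForm (𝓡 4) (punctured p) ℝ 2, IsSmoothForm α →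
      (∀ x : punctured p, ¬ InPuncturedChartBall p ε₃ x → α x = 0) → T α = 0 :=
    fun α hα hα0 => stub_collar p J hε hε₃ hε₃' hstd hT hsf_s hsft hω's hω'c hω'std hω'nn hc
      hω'pos hbound hα hα0
  -- the split `γ = φγ + (1 - φ)γ`
  have hφs' : ContMDiff (𝓡 4) 𝓘(ℝ, ℝ) ∞ (fun x => 1 - φ x) := contMDiff_const.sub hφs
  have hγ₁s : IsSmoothForm (φ • γ) := hγ.fun_smul' hφs
  have hγ₂s : IsSmoothForm ((fun x => 1 - φ x) • γ) := hγ.fun_smul' hφs'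
  have hsplit : γ = φ • γ + (fun x => 1 - φ x) • γ := by
    funext x
    simp only [Pi.add_apply, Pi.smul_apply']
    rw [← add_smul]
    simp
  have hdsplit : mextDeriv γ = mextDeriv (φ • γ) + mextDeriv ((fun x => 1 - φ x) • γ) := by
    conv_lhs => rw [hsplit]
    exact mextDeriv_add hγ₁s hγ₂s
  -- (W2) kills `d(φγ)`: closed, smooth, and `φγ ≡ 0` on the open ball `B_ε`
  have h1 : T (mextDeriv (φ • γ)) = 0 := by
    refine hT.eq_zero_of_vanishes (isSmoothForm_mextDeriv hd hγ₁s) (mextDeriv_mextDeriv hd hγ₁s)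
      fun x hx => ?_
    have hev : ∀ᶠ z in 𝓝 x, (φ • γ) z = (0 : MForm (𝓡 4) (punctured p) ℝ 1) z := by
      filter_upwards [(isOpen_setOf_inPuncturedChartBall p ε).mem_nhds hx] with z hz
      simp only [Pi.smul_apply', hφ0 z hz, zero_smul, Pi.zero_apply]
    rw [mextDeriv_congr_of_eventuallyEq hev, mextDeriv_zero]
    rfl
  -- the collar lemma kills `d((1-φ)γ)`: smooth and `≡ 0` near every point off `B_{ε₃}`
  have h2 : T (mextDeriv ((fun x => 1 - φ x) • γ)) = 0 := by
    refine hcollar _ (isSmoothForm_mextDeriv hd hγ₂s) fun x hx => ?_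
    have hev : ∀ᶠ z in 𝓝 x,
        ((fun x => 1 - φ x) • γ) z = (0 : MForm (𝓡 4) (punctured p) ℝ 1) z := by
      filter_upwards [hφ1 x hx] with z hz
      simp only [Pi.smul_apply', hz, sub_self, zero_smul, Pi.zero_apply]
    rw [mextDeriv_congr_of_eventuallyEq hev, mextDeriv_zero]
    rfl
  rw [hdsplit, map_add, h1, h2, add_zero] at hpos
  exact lt_irrefl 0 hpos

end Ctkw

end SullivanDual

end Summit.SmoothPoincare4.SmoothPoincare4.Theorems

end
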